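import Literature.MathematicalPhysics.QuantumFieldTheory.Balaban1983to89.HiggsDoubleRT
import Literature.MathematicalPhysics.QuantumFieldTheory.Balaban1983to89.B2Eq21FirstStep

/-!
# `Balaban1983to89.B1Eq338Rescaling` — T. Bałaban, *(Higgs)₂,₃ quantum fields in a finite volume. I. A lower bound*,
Commun. Math. Phys. **85** (1982) 603–626 [Balaban1982Higgs1]: **(3.37) → (3.38)** pp. 618–619 — the RESCALING of the
`(k+1)`-st step integral `T^{L^kε}_{a,L}[T^{L^kε}_{a,L,A^{(k),ε}}[χ_k(A)χ_k(φ)exp(−S^{(k),L^kε}(A,φ))]]` of (3.37) *"from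
L^kε-lattice T^{(k)}_{L^kε} to 1-lattice T^{(k)}_1"*, typed CONCRETELY over the (Higgs)₂,₃ carriers `…HiggsLattice` /
`…HiggsAveraging` / `…HiggsRescaling` / `…HiggsDoubleRT` and PROVED (the kernel algebra, the invariance of the bracket
under the canonical rescaling (1.22), the Jacobian of the change of variables) — the level-`k` version of the typer's
first-step file `…B2Eq21FirstStep` ((3.7) = the case `k = 0`); the printed display (3.38) itself (the bracket with the
action of the form (3.30) inserted) is the sibling module `…B1Eq338Display`

statement-level skeleton of published theorems with citation tags; proofs where landed; nothing here is a claim about the Yang–Mills mass gap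

PDF held: `paper:balaban1982-cmp85-higgs23-i` (journal page = PDF page + 602).  (3.37)–(3.40) pp. 618–619 READ AS IMAGES
on the ×2 renders `run/shared/lean/pub/pub-balaban/b2b-balaban-ref1/pages/1982-cmp85-higgs23-I/1982-cmp85-higgs23-I-p016-x2.png`,
`…-p017-x2.png`, never from the OCR layer.

CITATION HEADER (lean-in-tree rule).  lit-balaban typed skeleton (HOME `run/shared/lean/pub/lit-balaban/`), SKELETON row
**B1.Eq3.37–3.38** (reader r12 `lit-balaban-r12/ROWS-B1-part2.md` v4.8.1: «typed p245328 — the (3.37) member PROVED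
(`B1Ineq337Proof.ineq337`, p14 g3; model instance `B1Ineq337HiggsModel`, typer g3, p247729); the (3.38) member (rescaling
to the unit lattice, typer's `B2Eq21FirstStep` pattern) absent»).  THIS FILE + `…B1Eq338Display` = the (3.38) member.
WHAT IS REPRODUCED, verbatim, p. 618 bottom – p. 619 top [PDF 16–17]: *"and we have to calculate the internal integral
above. The first step in the calculation is a rescaling of all the fields and the propagators from L^kε-lattice
T^{(k)}_{L^kε} to 1-lattice T^{(k)}_1. After the rescaling the integral transforms into the integral
const χ_{k+1}(B)χ_{k+1}(ψ) ∫dA∫dφ χ_k(A)χ_k(φ) exp[−½aL^{d−2} Σ_{y∈T_L^{(k+1)}} |B(y) − (QA)(y)|²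
− ½aL^{d−2} Σ_{y∈T_L^{(k+1)}} |ψ(y) − (Q(A^{(k)})φ)(y)|² − ½⟨A, Δ^{(k)}A⟩ − … − E₀], (3.38)"*.

DICTIONARY.  `T^{L^kε}_{a,L}[T^{L^kε}_{a,L,Ã(A)}[ρ]](B, ψ)` = `HiggsDoubleRT.doubleRTk C a ext ρ B ψ` (typer g3, p247440:
the scalar-field transformation (2.4)–(2.7) at the external `ε`-lattice field `Ã(A) = ext A` — in (3.37) `Ã(A) = A^{(k),ε}`
of (3.29) —, then the vector-field transformation of p. 608); the canonical rescaling (1.22) p. 607 `A = σA′`, `φ = σφ′`,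
`σ = s^{(d−2)/2}`, from the `sL^kε`- to the `L^kε`-lattices = `HiggsRescaling.rescaleVec`/`rescaleScalar` with the lattice
`P.scaleBy s` and the rescaled charge `e_s` (`ChargeData.scaleBy`); the unit lattice `T^{(k)}_1` of p. 618 = `s = (L^kε)⁻¹`
(`unitScale`; level `k` has spacing `1`, level `k+1` spacing `L`, level `0` spacing `η = L^{−k}` as in (3.40):
`unit_mesh_k`, `unit_mesh_succ`, `unit_mesh_zero`); the background assignment `A ↦ Ã(A)` is rescaled like every field
(*"a rescaling of all the fields"*): conjugated, `extRescale`, so that `Ã(σA′) = σÃ₁(A′)`; `χ` = an arbitrary weight (the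
printed `χ_k(A)χ_k(φ)` is `B1Eq31Concrete.chiKA·chiKφ`); `S` = the k-th action (any function; the form (3.30) enters only in
`…B1Eq338Display`); `∫dA∫dφ` = iterated Lebesgue integrals (p. 605).

WHAT THIS FILE PROVES (0 `sorry`; standard axioms; no analytic hypothesis — both sides are Bochner integrals of the same
functions up to a measure-preserving relabeling and a homothety, exactly as in `B2Eq21FirstStep.doubleRT_rescale`):
* §1 `stepExponent` (the bracket `−½κΣ_y|B(y)−(QA)(y)|² − ½κΣ_y|ψ(y)−(Q(Ã(A))φ)(y)|² − S(A,φ)`, `κ = a(L^{k+1}ε)^{d−2}`)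
  and **`doubleRTk_exp`**: `T[T[χ·e^{−S}]](B,ψ) = kernelConstK · ∫dA∫dφ χ(A,φ)·exp(stepExponent)` at every level `k` (the
  two block kernels (2.5)–(2.6) are `const·exp` of the two Gaussian terms; `Q(0)` = the plain average, p. 608);
* §2 **`stepExponent_rescale`**: the bracket is INVARIANT under (1.22) when the charge, the background assignment and the
  action are rescaled (`B2Eq21FirstStep.avgQ_rescale`, `linAvg_rescaleScalar`; `prec_mul_sq_rescale_succ`:
  `a(L^{k+1}ε)^{d−2}σ² = a(L^{k+1}sε)^{d−2}` — the Gaussian terms of the transformation carry no weight `η^d`);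
* §3 **`doubleRTk_rescale`** — THE SENTENCE *"After the rescaling the integral transforms into"*: for block fields `B′, ψ′`
  of the `sL^kε`-family, `T[T[χe^{−S}]](σB′, σψ′) = rescaleConstK · ∫dA′∫dφ′ χ(σA′, σφ′) exp(stepExponent^{s}(B′,ψ′;A′,φ′))`
  (Jacobian: `B2Eq21FirstStep.integral_comp_rescaleVec/Scalar`), `rescaleConstK > 0` (`rescaleConstK_pos`); and the
  `dB dψ`-integral of (3.37) in the new variables, `integral_cutoff_doubleRTk_rescale`;
* §4 the unit lattice `s = (L^kε)⁻¹`: spacings `1`, `L`, `L^{−k}`; precision `aL^{d−2}` as printed in (3.38)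
  (`unit_prec_succ`); `unitScale_eq_unitAt`: this lattice IS `HiggsCovariance.Params.unitAt k` of (2.22), over which the
  rescaled propagators `G_k(Ω, A)` are constructed.
HONEST SCOPE.  (i) Convergence of the integrals is not part of the sentence and is neither used nor asserted.  (ii) The
action and the background assignment are arguments; see `…B1Eq338Display` for the printed bracket with the (3.30)
constituents.
Unit `lit-balaban-p14` gen 5 (Phase-2 proof seat p14, literature-prover-lit-balaban-p14-g5-0), HOME
`run/shared/lean/pub/lit-balaban/` (seat log `lit-balaban-p14/STATUS.md`).
-/

open scoped BigOperators
open _root_.MeasureTheory _root_.Real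

namespace Literature.MathematicalPhysics.QuantumFieldTheory.Balaban1983to89.B1Eq338Rescaling

open Literature.MathematicalPhysics.QuantumFieldTheory.Balaban1983to89.HiggsLattice
open Literature.MathematicalPhysics.QuantumFieldTheory.Balaban1983to89.HiggsAveraging
open Literature.MathematicalPhysics.QuantumFieldTheory.Balaban1983to89.HiggsRescaling
open Literature.MathematicalPhysics.QuantumFieldTheory.Balaban1983to89.HiggsDoubleRT
open Literature.MathematicalPhysics.QuantumFieldTheory.Balaban1983to89.B2Eq21FirstStep
open Literature.MathematicalPhysics.QuantumFieldTheory.Balaban1983to89.B3MultiscaleFields (toSite zeroCharge)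

variable {P : Params}

/-! ## 1. The bracket of the `(k+1)`-st step and the integrand of `T^{L^kε}_{a,L}[T^{L^kε}_{a,L,Ã(A)}[χe^{−S}]]` -/

section Exponent

variable {k N : ℕ}

/-- The exponent of the `(k+1)`-st step integrand BEFORE the rescaling ((3.37) p. 618 with (2.4)–(2.7) p. 608), as a
function of the block fields `B, ψ` on `T^{(k+1)}` and the fields `A, φ` on `T^{(k)}`:
`−½κ Σ_{y∈T^{(k+1)}} |B(y) − (QA)(y)|² − ½κ Σ_{y∈T^{(k+1)}} |ψ(y) − (Q(Ã(A))φ)(y)|² − S(A, φ)`, `κ = a(L^{k+1}ε)^{d−2}`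
(`B1RT.prec`, the precision of (2.6)), `QA` the plain block average of `x ↦ (A_μ(x))_μ` (p. 608), `Q(Ã(A))` the covariant
average (2.7) at the external field `Ã(A) = ext A` (`= A^{(k),ε}` of (3.29) in (3.37)), `S` the k-th action.  After the
rescaling to the unit lattice (`κ = aL^{d−2}`) and with `S` of the form (3.30) this is the bracket of (3.38)
(`stepExponent_unit_330`). [cite: Balaban1982Higgs1, (3.37)–(3.38) p.618–619] -/
noncomputable def stepExponent (C : ChargeData N) (a : ℝ) (ext : VecField P k → VecField P 0)
    (S : VecField P k → ScalarField P k N → ℝ) (B : VecField P (k + 1)) (ψ : ScalarField P (k + 1) N)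
    (A : VecField P k) (φ : ScalarField P k N) : ℝ :=
  -(B1RT.prec a (P.mesh (k + 1)) P.d / 2) * ∑ y : Site P (k + 1), ‖toSite B y - linAvg (toSite A) y‖ ^ 2
    - B1RT.prec a (P.mesh (k + 1)) P.d / 2 * ∑ y : Site P (k + 1), ‖ψ y - avgQ C (ext A) φ y‖ ^ 2
    - S A φ

/-- The constant factors of the two block kernels (2.5)–(2.6) at level `k` (the part of *"const"* in (3.38) coming from
the kernel normalizations): `((κ/2π)^{d/2})^{|T^{(k+1)}|} · ((κ/2π)^{N/2})^{|T^{(k+1)}|}`, `κ = a(L^{k+1}ε)^{d−2}`.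
[cite: Balaban1982Higgs1, (3.38) p.619] -/
noncomputable def kernelConstK (P : Params) (k N : ℕ) (a : ℝ) : ℝ :=
  ((B1RT.prec a (P.mesh (k + 1)) P.d / (2 * π)) ^ ((P.d : ℝ) / 2)) ^ Fintype.card (Site P (k + 1))
    * ((B1RT.prec a (P.mesh (k + 1)) P.d / (2 * π)) ^ ((N : ℝ) / 2)) ^ Fintype.card (Site P (k + 1))

/-- The kernel constant is positive for `a > 0`. [cite: Balaban1982Higgs1, (3.38) p.619] -/
theorem kernelConstK_pos (P : Params) (k N : ℕ) {a : ℝ} (ha : 0 < a) : 0 < kernelConstK P k N a := by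
  have hκ : 0 < B1RT.prec a (P.mesh (k + 1)) P.d / (2 * π) := div_pos (prec_step_pos (P := P) (k := k) ha) (by positivity)
  unfold kernelConstK
  exact mul_pos (pow_pos (Real.rpow_pos_of_pos hκ _) _) (pow_pos (Real.rpow_pos_of_pos hκ _) _)

/-- Regrouping of the bracket as a sum of its three terms (definitional up to `ring`). [cite: Balaban1982Higgs1, (3.38) p.619] -/
theorem stepExponent_eq_add (C : ChargeData N) (a : ℝ) (ext : VecField P k → VecField P 0)
    (S : VecField P k → ScalarField P k N → ℝ) (B : VecField P (k + 1)) (ψ : ScalarField P (k + 1) N)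
    (A : VecField P k) (φ : ScalarField P k N) :
    stepExponent C a ext S B ψ A φ
      = -(B1RT.prec a (P.mesh (k + 1)) P.d / 2) * ∑ y : Site P (k + 1), ‖toSite B y - linAvg (toSite A) y‖ ^ 2
        + -(B1RT.prec a (P.mesh (k + 1)) P.d / 2) * ∑ y : Site P (k + 1), ‖ψ y - avgQ C (ext A) φ y‖ ^ 2
        + -S A φ := by
  unfold stepExponent
  ring

/-- **The integrand of the `(k+1)`-st step** ((3.37) p. 618, with (2.4)–(2.7) p. 608): for every weight `χ(A, φ)` (↤
`χ_k(A)χ_k(φ)`) and action `S` (↤ `S^{(k),L^kε}`), at every level `k`,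
`T^{L^kε}_{a,L}[T^{L^kε}_{a,L,Ã(A)}[χ·e^{−S}]](B, ψ) = kernelConstK · ∫dA ∫dφ χ(A, φ) exp(stepExponent(B,ψ;A,φ))` — the two
kernels (2.5)–(2.6) contribute exactly the two Gaussian terms of the bracket and constant factors (vector fields: `N = d`,
external field `0`, `Q(0)` = the plain average, p. 608).  PROVED (pointwise algebra and linearity of the integral; no
convergence statement is used or made). [cite: Balaban1982Higgs1, (3.37)–(3.38) p.618–619] -/
theorem doubleRTk_exp (C : ChargeData N) (a : ℝ) (ext : VecField P k → VecField P 0)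
    (χ : VecField P k → ScalarField P k N → ℝ) (S : VecField P k → ScalarField P k N → ℝ)
    (B : VecField P (k + 1)) (ψ : ScalarField P (k + 1) N) :
    doubleRTk C a ext (fun A φ => χ A φ * Real.exp (-S A φ)) B ψ
      = kernelConstK P k N a
          * ∫ A : VecField P k, ∫ φ : ScalarField P k N, χ A φ * Real.exp (stepExponent C a ext S B ψ A φ) := by
  rw [doubleRTk_eq, ← integral_const_mul]
  congr 1
  funext A
  rw [← integral_const_mul, ← integral_const_mul]
  congr 1
  funext φ
  rw [vecKernel_eq, rtKernelStep, blockKernel_eq_const_mul_exp, blockKernel_eq_const_mul_exp, avgQ_zero,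
    stepExponent_eq_add, Real.exp_add, Real.exp_add, kernelConstK, finrank_euclideanSpace_fin, finrank_euclideanSpace_fin]
  ring

end Exponent

/-! ## 2. The bracket is invariant under the canonical rescaling (1.22) at every level -/

section Rescaling

variable {k N : ℕ} {s : ℝ}

/-- The Gaussian precision of the level-`k` kernels absorbs the field factor of (1.22): `a(L^{k+1}ε)^{d−2}·(s^{(d−2)/2})²
= a(L^{k+1}sε)^{d−2}` (the terms `|ψ(y) − (Q(A)φ)(y)|²` of (2.6) carry no weight `η^d` and are scale-free; level-`k`
version of `B2Eq21FirstStep.prec_mul_sq_rescale`). [cite: Balaban1982Higgs1, (3.38) p.619] -/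
theorem prec_mul_sq_rescale_succ (hs : 0 < s) (a : ℝ) :
    B1RT.prec a (P.mesh (k + 1)) P.d * (s ^ (((P.d : ℝ) - 2) / 2)) ^ 2
      = B1RT.prec a ((P.scaleBy s hs).mesh (k + 1)) (P.scaleBy s hs).d := by
  have hσ : (s ^ (((P.d : ℝ) - 2) / 2)) ^ 2 = s ^ ((P.d : ℤ) - 2) := by
    rw [← Real.rpow_natCast _ 2, ← Real.rpow_mul hs.le, ← Real.rpow_intCast]
    congr 1
    push_cast
    ring
  rw [hσ, scaleBy_d, mesh_scaleBy, B1RT.prec_eq, B1RT.prec_eq, mul_zpow]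
  ring

/-- The background assignment `A ↦ Ã(A)` (`= A^{(k),ε}` of (3.29)) CONJUGATED by the rescaling (1.22): on the rescaled
family, `Ã₁(A′) := σ⁻¹·Ã(σA′)` (same bond labels), `σ = s^{(d−2)/2}` — the background field is rescaled like every other
field (*"a rescaling of all the fields"*, p. 618; in (3.38) `A^{(k)}` is the rescaled `A^{(k),ε}`). [cite: Balaban1982Higgs1, (3.38) p.619] -/
noncomputable def extRescale (hs : 0 < s) (ext : VecField P k → VecField P 0) :
    VecField (P.scaleBy s hs) k → VecField (P.scaleBy s hs) 0 :=
  fun A' b => (s ^ (((P.d : ℝ) - 2) / 2))⁻¹ * ext (rescaleVec hs A') ⟨b.src, b.dir⟩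

/-- The conjugated assignment is compatible with the rescaling: `σ·Ã₁(A′) = Ã(σA′)`. [cite: Balaban1982Higgs1, (3.38) p.619] -/
theorem rescaleVec_extRescale (hs : 0 < s) (ext : VecField P k → VecField P 0) (A' : VecField (P.scaleBy s hs) k) :
    rescaleVec hs (extRescale hs ext A') = ext (rescaleVec hs A') := by
  have hσ : s ^ (((P.d : ℝ) - 2) / 2) ≠ 0 := (Real.rpow_pos_of_pos hs _).ne'
  funext b
  simp only [rescaleVec, extRescale]
  rw [← mul_assoc, mul_inv_cancel₀ hσ, one_mul]

/-- **The bracket is invariant under the canonical rescaling (1.22)** (p. 618: *"a rescaling of all the fields and the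
propagators from L^kε-lattice … to 1-lattice"*; general factor `s > 0`, `s = (L^kε)⁻¹` in print): for block and fine
fields `B′, ψ′, A′, φ′` of the rescaled family and their rescalings (1.22), with the rescaled charge `e_s` (p. 607), a
background assignment `Ã₁` compatible with `Ã` (`σÃ₁(A′) = Ã(σA′)`, e.g. `extRescale`) and the pulled-back action
`S₁(A′, φ′) = S(σA′, σφ′)`:  `stepExponent(σB′, σψ′; σA′, σφ′) = stepExponent^{s}(B′, ψ′; A′, φ′)`.  PROVED: the two
Gaussian terms scale by `σ²` (`B2Eq21FirstStep.linAvg_rescaleScalar`, `avgQ_rescale` — the transports satisfy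
`U_e(ε·σA′(Γ)) = U_{e_s}(sε·A′(Γ))`) and `κσ² = κ^{s}` (`prec_mul_sq_rescale_succ`). [cite: Balaban1982Higgs1, (3.38) p.619] -/
theorem stepExponent_rescale (hs : 0 < s) (C : ChargeData N) (a : ℝ) {ext : VecField P k → VecField P 0}
    {ext' : VecField (P.scaleBy s hs) k → VecField (P.scaleBy s hs) 0}
    (hext : ∀ A', rescaleVec hs (ext' A') = ext (rescaleVec hs A')) (S : VecField P k → ScalarField P k N → ℝ)
    (B' : VecField (P.scaleBy s hs) (k + 1)) (ψ' : ScalarField (P.scaleBy s hs) (k + 1) N)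
    (A' : VecField (P.scaleBy s hs) k) (φ' : ScalarField (P.scaleBy s hs) k N) :
    stepExponent C a ext S (rescaleVec hs B') (rescaleScalar hs ψ') (rescaleVec hs A') (rescaleScalar hs φ')
      = stepExponent (P := P.scaleBy s hs) (C.scaleBy P.d s) a ext'
          (fun A φ => S (rescaleVec hs A) (rescaleScalar hs φ)) B' ψ' A' φ' := by
  have h1 : ∑ y : Site P (k + 1), ‖toSite (rescaleVec hs B') y - linAvg (toSite (rescaleVec hs A')) y‖ ^ 2
      = (s ^ (((P.d : ℝ) - 2) / 2)) ^ 2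
          * ∑ y : Site (P.scaleBy s hs) (k + 1), ‖toSite B' y - linAvg (toSite A') y‖ ^ 2 := by
    rw [toSite_rescaleVec hs B', toSite_rescaleVec hs A', linAvg_rescaleScalar hs, Finset.mul_sum]
    refine Finset.sum_congr rfl fun y _ => ?_
    simp only [rescaleScalar, ← smul_sub, norm_smul, mul_pow, Real.norm_of_nonneg (Real.rpow_nonneg hs.le _)]
    rfl
  have h2 : ∑ y : Site P (k + 1),
        ‖rescaleScalar hs ψ' y - avgQ C (ext (rescaleVec hs A')) (rescaleScalar hs φ') y‖ ^ 2
      = (s ^ (((P.d : ℝ) - 2) / 2)) ^ 2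
          * ∑ y : Site (P.scaleBy s hs) (k + 1),
              ‖ψ' y - avgQ (P := P.scaleBy s hs) (C.scaleBy P.d s) (ext' A') φ' y‖ ^ 2 := by
    rw [← hext A', avgQ_rescale hs C (ext' A') φ', Finset.mul_sum]
    refine Finset.sum_congr rfl fun y _ => ?_
    simp only [rescaleScalar]
    rw [← smul_sub, norm_smul, mul_pow, Real.norm_of_nonneg (Real.rpow_nonneg hs.le _)]
  unfold stepExponent
  rw [h1, h2, ← prec_mul_sq_rescale_succ hs a]
  ring

end Rescaling

/-! ## 3. The change of variables: *"After the rescaling the integral transforms into …"* (p. 618–619) -/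

section ChangeOfVariables

variable {k N : ℕ} {s : ℝ}

/-- *"const"* of (3.38): the kernel normalizations (`kernelConstK`) times the Jacobian
`σ^{|bonds of T^{(k)}|}·σ^{N|T^{(k)}|}` of the linear change of variables `(A, φ) = (σA′, σφ′)` (1.22) in `dA dφ`,
`σ = s^{(d−2)/2}` (`s = (L^kε)⁻¹` in print). [cite: Balaban1982Higgs1, (3.38) p.619] -/
noncomputable def rescaleConstK (P : Params) (k N : ℕ) (a s : ℝ) : ℝ :=
  kernelConstK P k N a * ((s ^ (((P.d : ℝ) - 2) / 2)) ^ Fintype.card (PBond P k)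
    * (s ^ (((P.d : ℝ) - 2) / 2)) ^ (N * Fintype.card (Site P k)))

/-- The constant of (3.38) is positive (`a > 0`, `s > 0`). [cite: Balaban1982Higgs1, (3.38) p.619] -/
theorem rescaleConstK_pos (P : Params) (k N : ℕ) {a s : ℝ} (ha : 0 < a) (hs : 0 < s) :
    0 < rescaleConstK P k N a s := by
  have hσ : 0 < s ^ (((P.d : ℝ) - 2) / 2) := Real.rpow_pos_of_pos hs _
  unfold rescaleConstK
  exact mul_pos (kernelConstK_pos P k N ha) (mul_pos (pow_pos hσ _) (pow_pos hσ _))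

/-- **p. 618–619: "The first step in the calculation is a rescaling of all the fields and the propagators from
L^kε-lattice T^{(k)}_{L^kε} to 1-lattice T^{(k)}_1. After the rescaling the integral transforms into the integral
const … ∫dA∫dφ …"** — typed reading, for a general factor `s > 0` (`s = (L^kε)⁻¹` in print), every weight `χ` and every
action `S`: the double transformation of `χ·e^{−S}` at the rescalings (1.22) of block fields `B′, ψ′` of the rescaled
family equals `rescaleConstK` times the integral over the fields `A′, φ′` of the rescaled family of
`χ(σA′, σφ′)·exp(stepExponent^{s}(B′, ψ′; A′, φ′))` — the bracket with the rescaled charge, the conjugated background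
assignment `Ã₁` (`hext`) and the pulled-back action.  PROVED from `doubleRTk_exp`, `stepExponent_rescale` and the
change-of-variables lemmas `B2Eq21FirstStep.integral_comp_rescaleVec`/`integral_comp_rescaleScalar` (bond relabeling is
measure preserving, the homothety scales Lebesgue measure); no convergence is used — both sides are Bochner integrals of
the same functions. [cite: Balaban1982Higgs1, (3.38) p.619] -/
theorem doubleRTk_rescale (hs : 0 < s) (C : ChargeData N) (a : ℝ) {ext : VecField P k → VecField P 0}
    {ext' : VecField (P.scaleBy s hs) k → VecField (P.scaleBy s hs) 0}
    (hext : ∀ A', rescaleVec hs (ext' A') = ext (rescaleVec hs A'))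
    (χ : VecField P k → ScalarField P k N → ℝ) (S : VecField P k → ScalarField P k N → ℝ)
    (B' : VecField (P.scaleBy s hs) (k + 1)) (ψ' : ScalarField (P.scaleBy s hs) (k + 1) N) :
    doubleRTk C a ext (fun A φ => χ A φ * Real.exp (-S A φ)) (rescaleVec hs B') (rescaleScalar hs ψ')
      = rescaleConstK P k N a s
          * ∫ A' : VecField (P.scaleBy s hs) k, ∫ φ' : ScalarField (P.scaleBy s hs) k N,
              χ (rescaleVec hs A') (rescaleScalar hs φ')
                * Real.exp (stepExponent (P := P.scaleBy s hs) (C.scaleBy P.d s) a ext'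
                    (fun A φ => S (rescaleVec hs A) (rescaleScalar hs φ)) B' ψ' A' φ') := by
  rw [doubleRTk_exp]
  have h1 : (∫ A' : VecField (P.scaleBy s hs) k, ∫ φ' : ScalarField (P.scaleBy s hs) k N,
        χ (rescaleVec hs A') (rescaleScalar hs φ')
          * Real.exp (stepExponent (P := P.scaleBy s hs) (C.scaleBy P.d s) a ext'
              (fun A φ => S (rescaleVec hs A) (rescaleScalar hs φ)) B' ψ' A' φ'))
      = |((s ^ (((P.d : ℝ) - 2) / 2)) ^ Fintype.card (PBond P k))⁻¹|
          * ∫ A : VecField P k, ∫ φ' : ScalarField (P.scaleBy s hs) k N,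
              χ A (rescaleScalar hs φ')
                * Real.exp (stepExponent C a ext S (rescaleVec hs B') (rescaleScalar hs ψ') A
                    (rescaleScalar hs φ')) := by
    rw [← integral_comp_rescaleVec hs]
    simp_rw [stepExponent_rescale hs C a hext S]
  have h2 : ∀ A : VecField P k,
      (∫ φ' : ScalarField (P.scaleBy s hs) k N,
          χ A (rescaleScalar hs φ')
            * Real.exp (stepExponent C a ext S (rescaleVec hs B') (rescaleScalar hs ψ') A (rescaleScalar hs φ')))
        = |((s ^ (((P.d : ℝ) - 2) / 2)) ^ (N * Fintype.card (Site P k)))⁻¹|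
            * ∫ φ : ScalarField P k N,
                χ A φ * Real.exp (stepExponent C a ext S (rescaleVec hs B') (rescaleScalar hs ψ') A φ) :=
    fun A => integral_comp_rescaleScalar hs
      (fun φ => χ A φ * Real.exp (stepExponent C a ext S (rescaleVec hs B') (rescaleScalar hs ψ') A φ))
  rw [h1]
  simp_rw [h2]
  rw [integral_const_mul]
  have hσ : 0 < s ^ (((P.d : ℝ) - 2) / 2) := Real.rpow_pos_of_pos hs _
  have hn1 : 0 < (s ^ (((P.d : ℝ) - 2) / 2)) ^ Fintype.card (PBond P k) := pow_pos hσ _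
  have hn2 : 0 < (s ^ (((P.d : ℝ) - 2) / 2)) ^ (N * Fintype.card (Site P k)) := pow_pos hσ _
  rw [abs_of_pos (inv_pos.mpr hn1), abs_of_pos (inv_pos.mpr hn2)]
  unfold rescaleConstK
  field_simp

/-- The `dB dψ`-integral of (3.37) in the new variables: for any outer weight `χ′(B, ψ)` (↤ `χ_{k+1}(B)χ_{k+1}(ψ)`),
`∫dB′∫dψ′ χ′(σB′, σψ′)·T[T[χe^{−S}]](σB′, σψ′) = σ^{−(|bonds|+N|sites|) of T^{(k+1)}} · ∫dB∫dψ χ′(B, ψ)·T[T[χe^{−S}]](B, ψ)`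
— the Jacobian of (1.22) for the block fields (`HiggsRescaling.integral_comp_rescale` at level `k+1`). [cite: Balaban1982Higgs1, (3.37)–(3.38) p.618–619] -/
theorem integral_cutoff_doubleRTk_rescale (hs : 0 < s) (C : ChargeData N) (a : ℝ) (ext : VecField P k → VecField P 0)
    (χ' : VecField P (k + 1) → ScalarField P (k + 1) N → ℝ) (ρ : VecField P k → ScalarField P k N → ℝ) :
    ∫ Ψ' : VecField (P.scaleBy s hs) (k + 1) × ScalarField (P.scaleBy s hs) (k + 1) N,
        χ' (rescaleVec hs Ψ'.1) (rescaleScalar hs Ψ'.2)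
          * doubleRTk C a ext ρ (rescaleVec hs Ψ'.1) (rescaleScalar hs Ψ'.2)
      = |((s ^ (((P.d : ℝ) - 2) / 2))
            ^ (Fintype.card (PBond P (k + 1)) + N * Fintype.card (Site P (k + 1))))⁻¹|
          * ∫ Ψ : VecField P (k + 1) × ScalarField P (k + 1) N, χ' Ψ.1 Ψ.2 * doubleRTk C a ext ρ Ψ.1 Ψ.2 :=
  integral_comp_rescale hs (fun Ψ : VecField P (k + 1) × ScalarField P (k + 1) N =>
    χ' Ψ.1 Ψ.2 * doubleRTk C a ext ρ Ψ.1 Ψ.2)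

end ChangeOfVariables

/-! ## 4. The unit lattice `T^{(k)}_1`: `s = (L^kε)⁻¹` (p. 618; spacings `1`, `L`, `η = L^{−k}` as in (3.38)–(3.40)) -/

section UnitLattice

/-- The rescaling factor taking the `L^kε`-lattice `T^{(k)}_{L^kε}` to the unit lattice `T^{(k)}_1` (p. 618): `s = (L^kε)⁻¹`.
[cite: Balaban1982Higgs1, (3.38) p.619] -/
noncomputable def unitScale (P : Params) (k : ℕ) : ℝ := (P.mesh k)⁻¹

/-- `(L^kε)⁻¹ > 0`. [cite: Balaban1982Higgs1, (3.38) p.619] -/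
theorem unitScale_pos (P : Params) (k : ℕ) : 0 < unitScale P k := inv_pos.mpr (P.mesh_pos k)

/-- `L^{k+1}ε = L · L^kε` ((1.19) p. 607). [cite: Balaban1982Higgs1, (1.19) p.607] -/
theorem mesh_succ (P : Params) (k : ℕ) : P.mesh (k + 1) = P.L * P.mesh k := by
  unfold Params.mesh
  rw [pow_succ]
  ring

/-- After the rescaling by `(L^kε)⁻¹` the level-`k` lattice is the UNIT lattice `T^{(k)}_1` of p. 618. [cite: Balaban1982Higgs1, (3.38) p.619] -/
theorem unit_mesh_k (P : Params) (k : ℕ) : (P.scaleBy (unitScale P k) (unitScale_pos P k)).mesh k = 1 := by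
  rw [mesh_scaleBy, unitScale, inv_mul_cancel₀ (P.mesh_pos k).ne']

/-- … its block lattice `T^{(k+1)}_L` has spacing `L` (the subscript of `Σ_{y∈T_L^{(k+1)}}` in (3.38)). [cite: Balaban1982Higgs1, (3.38) p.619] -/
theorem unit_mesh_succ (P : Params) (k : ℕ) : (P.scaleBy (unitScale P k) (unitScale_pos P k)).mesh (k + 1) = P.L := by
  rw [mesh_scaleBy, mesh_succ, unitScale, mul_left_comm, inv_mul_cancel₀ (P.mesh_pos k).ne', mul_one]

/-- … and its finest lattice has spacing `η = L^{−k}` (the `η` of `(2πη^d)` in (3.40)). [cite: Balaban1982Higgs1, (3.40) p.619] -/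
theorem unit_mesh_zero (P : Params) (k : ℕ) :
    (P.scaleBy (unitScale P k) (unitScale_pos P k)).mesh 0 = ((P.L : ℝ) ^ k)⁻¹ := by
  rw [mesh_scaleBy, unitScale]
  unfold Params.mesh
  rw [pow_zero, one_mul, mul_inv, mul_assoc, inv_mul_cancel₀ P.hε.ne', mul_one]

/-- On the unit lattice the precision of the level-`k` kernels is `aL^{d−2}` — the coefficient `½aL^{d−2}` printed in
(3.38). [cite: Balaban1982Higgs1, (3.38) p.619] -/
theorem unit_prec_succ (P : Params) (k : ℕ) (a : ℝ) :
    B1RT.prec a ((P.scaleBy (unitScale P k) (unitScale_pos P k)).mesh (k + 1))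
        (P.scaleBy (unitScale P k) (unitScale_pos P k)).d
      = a * (P.L : ℝ) ^ ((P.d : ℤ) - 2) := by
  rw [unit_mesh_succ, B1RT.prec_eq, scaleBy_d]

/-- The unit lattice of p. 618 IS the rescaled parameter record `Params.unitAt k` of (2.22) p. 610 (`HiggsCovariance`:
`ε ↦ L^{−k}`), over which the rescaled propagators `G_k(Ω, A)` are constructed. [cite: Balaban1982Higgs1, (2.22) p.610] -/
theorem unitScale_eq_unitAt (P : Params) (k : ℕ) :
    P.scaleBy (unitScale P k) (unitScale_pos P k) = P.unitAt k := by
  have h : unitScale P k * P.ε = ((P.L : ℝ) ^ k)⁻¹ := by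
    rw [unitScale]
    unfold Params.mesh
    rw [mul_inv, mul_assoc, inv_mul_cancel₀ P.hε.ne', mul_one]
  unfold Params.scaleBy Params.unitAt
  congr 1

end UnitLattice

end Literature.MathematicalPhysics.QuantumFieldTheory.Balaban1983to89.B1Eq338Rescaling
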